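import Literature.RingTheory.AdicTopology.PrincipalCompletion
import Literature.NumberTheory.EllipticCurves.PadicWeierstrassZetaProofs
import Mathlib.RingTheory.Localization.Away.Basic
import Mathlib.RingTheory.Localization.Ideal
import Mathlib.Algebra.MvPolynomial.CommRing
import Mathlib.RingTheory.Polynomial.Basic
import Mathlib.RingTheory.ZMod
import Mathlib.Algebra.CharP.Quotient
import Mathlib.Algebra.CharP.Lemmas
import Mathlib.FieldTheory.Finite.Basic
import Mathlib.Data.Nat.Factorization.Basic
import Mathlib.Data.Nat.Prime.Factorial
import HarnessLib

/-!
# The universal ordinary Weierstrass curve: the ring `R̂ = ℤ[A₄, A₆][1/H]^∧_p`, its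
# specialisations and its Frobenius lifts (Blakestad–Grant 2023, §2.1–2.2, Def. 8, Thm. 15)

Trunk T-NT-EC (Literature/NumberTheory/EllipticCurves). Infrastructure for the existence half of
the tree's named fact `WeierstrassCurve.mazur_tate_sigma_existsUnique` (Mazur–Stein–Tate 2006,
Thm. 1.3) along Blakestad–Grant, *On the universal `p`-adic sigma and Weierstrass zeta
functions*, J. Number Theory 249 (2023): every known proof of the integrality of the Mazur–Tate
sigma function is UNIVERSAL — it works over the `p`-adic completion `R̂` of
`R_H = ℤ[A₄, A₆][1/H]` (`H` the Hasse polynomial), where the Frobenius endomorphism `α` of Def. 8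
lives (a single curve over `ℤ_p` has no `α`), and then specialises (Thm. 15). The tree's `p`-adic
zeta/sigma files (`PadicWeierstrassZetaProofs`, `PadicSigmaOfZetaProofs`, …) are written over an
abstract base `[CommRing R] [IsAddTorsionFree R] [IsAdicComplete (Ideal.span {(p : R)}) R]` with
unit Hasse coefficients; this file constructs THE base and proves it has all these properties:

* `coeffRing = ℤ[A₄, A₆]` (`MvPolynomial (Fin 2) ℤ`), `A₄`, `A₆`, the universal short curve
  `curve : y² = x³ + A₄x + A₆`, and the **Hasse polynomial** `hasse p = curve.hasseCoeff p`
  (the tree's `hasseCoeff`: coefficient of `x^{p-1}` in `(4x³ + 4A₄x + 4A₆)^{(p-1)/2}`, i.e.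
  `4^{(p-1)/2}` times Blakestad–Grant's `H`);
* **`hasse_map_ne_zero`, `hasse_ne_zero`: `H ≢ 0 (mod p)` for `p ≥ 5`** — by the explicit
  double binomial expansion `coeff_cube_add_pow` / `mvCoeff_coeff_cube_add_pow`: the monomial
  `A₄ᴶA₆ᴷ` (`2J + 3K = (p-1)/2`) of `[x^{p-1}](x³ + A₄x + A₆)^{(p-1)/2}` has coefficient
  `C(m, m-K)·C(m-K, m-K-J)`, prime to `p`; hence `(p)` is a prime ideal of `ℤ[A₄,A₆]` not meeting
  `H^ℕ` (`span_natCast_isPrime`, `disjoint_powers_hasse_span`);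
* `localizedRing p = R_H` (`Localization.Away`): a domain, `(p)` prime, no `p`-torsion, `H` a unit;
* **`completeRing p = R̂`** (`AdicCompletion (p) R_H`) with `univA₄`, `univA₆`,
  **`universalCurve p = 𝓔 : y² = x³ + A₄x + A₆` over `R̂`**, and: instance
  `IsAdicComplete (Ideal.span {(p : R̂)}) R̂`; `isDomain_completeRing` (**`R̂` is a domain**,
  so Blakestad–Grant's "fraction field `K` of `R̂`" makes sense); `isAddTorsionFree_completeRing`;
  `charP_quotient` (`R̂/(p)` has characteristic `p`); `isUnit_algebraMap_hasse_completeRing`,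
  `isUnit_hasseCoeff_universalCurve`, and **`isUnit_coeff_formalInvDiff_universalCurve[_pow]`:
  the Hasse coefficients `w_{pⁿ-1}` of `ω_𝓔` are units** (ordinarity, the hypothesis of
  Blakestad–Grant's Thm. 2 = the tree's `exists_padicWeierstrassZetaConst`) — all for `p ≥ 5`;
* **`specialize p a₄ a₆ h : R̂ →+* A`** (Thm. 15: `ρ(A₄) = a₄`, `ρ(A₆) = a₆` for a curve
  `y² = x³ + a₄x + a₆` with unit Hasse coefficient over a `p`-adically complete ring `A`, e.g.
  `ℤ_p` at a good ordinary prime), `universalCurve_map_specialize : ρ_* 𝓔 = ⟨0,0,0,a₄,a₆⟩`, and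
  `ringHom_ext`: maps out of `R̂` into a `p`-adically separated ring are determined by the images
  of `A₄, A₆`;
* **`frobeniusLift p A'₄ A'₆ h₄ h₆ : R̂ →+* R̂`** (Def. 8): for `A'ᵢ ≡ Aᵢᵖ (mod p)` the unique
  endomorphism `α` with `α(Aᵢ) = A'ᵢ`; `frobeniusLift_sub_pow_mem : α(x) ≡ xᵖ (mod p)` for ALL
  `x ∈ R̂` (the hypothesis `α(r) - rᵖ ∈ pA` of the tree's Dwork / functional-equation lemmas,
  `Literature.RingTheory.FormalGroups.coeff_exp_subst_mem_of_functionalEquation_subst`), and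
  `isUnit_hasseCoeff_map_frobeniusLift` (`α_*𝓔` is again ordinary: `H' ≡ Hᵖ`);
* `isUnit_hasseCoeff_iff_isUnit_coeff_formalInvDiff` — over ANY `p`-adically complete ring the
  Hasse coefficient is a unit iff `w_{p-1}` is (the bridge from the tree's ordinarity hypothesis
  `‖c_{p-1}‖ = 1` to the hypothesis of `specialize`).

What this file does NOT do: produce Blakestad–Grant's specific `A'ᵢ = A'_{i,p/H}` (Prop. 7, the
quotient of `𝓔` by its canonical subgroup) — that is the remaining algebro-geometric input of
their Thm. 1; given it, `frobeniusLift` is their `α`.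

## Sources

* C. Blakestad, D. Grant, *On the universal `p`-adic sigma and Weierstrass zeta functions*,
  J. Number Theory 249 (2023) 348–376 (arXiv:1903.02480): §2.1 (the rings `R = ℤ[1/6][A₄,A₆]`,
  `R_H`, `R̂`, `H`, the universal curve), §2.2 Def. 8 (`α`), Thm. 15 (`ρ`). [BlakestadGrant2023]
* N. M. Katz, *p-adic properties of modular schemes and modular forms*, LNM 350 (1973), §2.0–2.1
  (the Hasse invariant as the coefficient of `x^{p-1}`; ordinary locus `H` invertible). [folklore]
* J. H. Silverman, *AEC* 2nd ed. (2009), V.4.1 (Deuring's formula for the Hasse invariant).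

## Design notes

* We take `R = ℤ[A₄, A₆]` rather than `ℤ[1/6][A₄, A₆]`: after `p`-adic completion every integer
  prime to `p` is a unit (`isUnit_natCast_of_coprime`), so for `p ≥ 5` nothing is lost and the
  specialisation to `ℤ_p`-curves needs no `1/6`.
* `coeffRing`, `localizedRing`, `completeRing` are `abbrev`s of Mathlib types (so all instances —
  `CommRing`, `Algebra`, `IsLocalization.Away` — are Mathlib's); the generic completion facts are
  `Literature.RingTheory.AdicTopology.*` (`PrincipalCompletion.lean`).
* Results needing `H ≢ 0 (mod p)` carry `(hp5 : 5 ≤ p)`; for `p = 3` the Hasse polynomial of the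
  short family vanishes identically and `R̂ = 0`.
* Definitions introduced (all with bodies): `coeffRing`, `A₄`, `A₆`, `curve`, `hasse`,
  `localizedRing`, `completeRing`, `univA₄`, `univA₆`, `universalCurve`, `specializeAway`,
  `specialize`, `frobeniusPoly`, `frobeniusAway`, `frobeniusLift`. No named facts.
-/

noncomputable section

open Polynomial Finset

namespace Literature.NumberTheory.EllipticCurves.UniversalOrdinary

open Literature.RingTheory.AdicTopology

/-! ## The coefficient of `x^{2m}` in `(x³ + A₄x + A₆)^m` -/

section HasseComputation
variable {S : Type*} [CommRing S]

/-- `(x³ + ax + b)^m` expanded twice by the binomial theorem: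
`Σ_{j ≤ k ≤ m} C(m,k) C(k,j) a^{k-j} b^{m-k} x^{k+2j}`. [folklore] -/
theorem cube_add_pow_eq_sum (a b : S) (m : ℕ) :
    (X ^ 3 + C a * X + C b) ^ m = ∑ k ∈ range (m + 1), ∑ j ∈ range (k + 1),
      C ((m.choose k : S) * (k.choose j : S) * a ^ (k - j) * b ^ (m - k)) * X ^ (k + 2 * j) := by
  rw [add_pow]
  refine sum_congr rfl fun k _ => ?_
  rw [add_pow, sum_mul, sum_mul]
  refine sum_congr rfl fun j hj => ?_
  obtain ⟨i, rfl⟩ := Nat.exists_eq_add_of_le (Nat.lt_succ_iff.mp (mem_range.mp hj))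
  rw [Nat.add_sub_cancel_left]
  simp only [map_mul, map_pow, map_natCast]
  have hx : (X : S[X]) ^ (j + i + 2 * j) = (X ^ 3) ^ j * X ^ i := by
    rw [← pow_mul, ← pow_add]; congr 1; ring
  rw [hx]
  ring

/-- The coefficient of `x^{2m}` in `(x³ + ax + b)^m`. [folklore] -/
theorem coeff_cube_add_pow (a b : S) (m : ℕ) :
    ((X ^ 3 + C a * X + C b) ^ m).coeff (2 * m) = ∑ k ∈ range (m + 1), ∑ j ∈ range (k + 1),
      if k + 2 * j = 2 * m then (m.choose k : S) * (k.choose j : S) * a ^ (k - j) * b ^ (m - k)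
      else 0 := by
  rw [cube_add_pow_eq_sum, finsetSum_coeff]
  refine sum_congr rfl fun k _ => ?_
  rw [finsetSum_coeff]
  refine sum_congr rfl fun j _ => ?_
  rw [coeff_C_mul_X_pow]
  by_cases h : k + 2 * j = 2 * m
  · rw [if_pos h, if_pos h.symm]
  · rw [if_neg h, if_neg (Ne.symm h)]

/-- Exponent vectors `(e, e')` on two variables are determined by their values. [folklore] -/
theorem single_add_single_eq_iff {e e' J K : ℕ} :
    Finsupp.single (0 : Fin 2) e + Finsupp.single 1 e' = Finsupp.single 0 J + Finsupp.single 1 K ↔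
      e = J ∧ e' = K := by
  constructor
  · intro h
    have h0 := DFunLike.congr_fun h 0
    have h1 := DFunLike.congr_fun h 1
    simp only [Finsupp.coe_add, Pi.add_apply, Finsupp.single_eq_same, Fin.isValue, ne_eq,
      zero_ne_one, not_false_eq_true, Finsupp.single_eq_of_ne, add_zero, one_ne_zero,
      zero_add] at h0 h1
    exact ⟨h0, h1⟩
  · rintro ⟨rfl, rfl⟩
    rfl

/-- In `T[A₄, A₆]`: the coefficient of `A₄ᴶ A₆ᴷ` in `C(m,k)C(k,j) A₄^{k-j} A₆^{m-k}`. [folklore] -/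
theorem mvCoeff_term {T : Type*} [CommRing T] (m k j J K : ℕ) :
    MvPolynomial.coeff (Finsupp.single 0 J + Finsupp.single 1 K)
      ((m.choose k : MvPolynomial (Fin 2) T) * (k.choose j : MvPolynomial (Fin 2) T) *
        MvPolynomial.X 0 ^ (k - j) * MvPolynomial.X 1 ^ (m - k)) =
      if k - j = J ∧ m - k = K then ((m.choose k : T) * (k.choose j : T)) else 0 := by
  classical
  have h : ((m.choose k : MvPolynomial (Fin 2) T) * (k.choose j : MvPolynomial (Fin 2) T) *
        MvPolynomial.X 0 ^ (k - j) * MvPolynomial.X 1 ^ (m - k)) =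
      MvPolynomial.monomial (Finsupp.single 0 (k - j) + Finsupp.single 1 (m - k))
        ((m.choose k : T) * (k.choose j : T)) := by
    rw [MvPolynomial.X_pow_eq_monomial, MvPolynomial.X_pow_eq_monomial, ← map_natCast MvPolynomial.C,
      ← map_natCast MvPolynomial.C, ← map_mul, mul_assoc, MvPolynomial.monomial_mul,
      MvPolynomial.C_mul_monomial, mul_one, mul_one]
  rw [h, MvPolynomial.coeff_monomial]
  by_cases hc : k - j = J ∧ m - k = K
  · rw [if_pos hc, if_pos (single_add_single_eq_iff.mpr hc)]
  · rw [if_neg hc, if_neg (fun h' => hc (single_add_single_eq_iff.mp h'))]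

/-- **The coefficient of `A₄ᴶA₆ᴷ x^{2m}` in `(x³ + A₄x + A₆)^m` is `C(m, m-K)·C(m-K, m-K-J)`**
whenever `2J + 3K = m` (the monomials of the Hasse polynomial are indexed by `2J + 3K = m`, each
arising from exactly one term of the double binomial expansion). [folklore] -/
theorem mvCoeff_coeff_cube_add_pow {T : Type*} [CommRing T] {m J K : ℕ} (hJK : 2 * J + 3 * K = m) :
    MvPolynomial.coeff (Finsupp.single 0 J + Finsupp.single 1 K)
      (((X ^ 3 + C (MvPolynomial.X (0 : Fin 2)) * X + C (MvPolynomial.X (1 : Fin 2))) ^ m).coeff (2 * m) :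
        MvPolynomial (Fin 2) T) =
      (m.choose (m - K) : T) * ((m - K).choose (m - K - J) : T) := by
  rw [coeff_cube_add_pow, MvPolynomial.coeff_sum]
  have hKm : K ≤ m := by omega
  have hJm : J ≤ m - K := by omega
  rw [sum_eq_single (m - K)]
  · rw [MvPolynomial.coeff_sum, sum_eq_single (m - K - J)]
    · have hcond : m - K + 2 * (m - K - J) = 2 * m := by omega
      rw [if_pos hcond, mvCoeff_term m (m - K) (m - K - J) J K,
        if_pos ⟨by omega, by omega⟩]
    · intro j hj hne
      have hj' : j ≤ m - K := Nat.lt_succ_iff.mp (mem_range.mp hj)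
      split_ifs with hcond
      · rw [mvCoeff_term m (m - K) j J K, if_neg]
        omega
      · exact MvPolynomial.coeff_zero _
    · intro h
      exact absurd (mem_range.mpr (by omega)) h
  · intro k hk hne
    have hk' : k ≤ m := Nat.lt_succ_iff.mp (mem_range.mp hk)
    rw [MvPolynomial.coeff_sum]
    refine sum_eq_zero fun j hj => ?_
    have hj' : j ≤ k := Nat.lt_succ_iff.mp (mem_range.mp hj)
    split_ifs with hcond
    · rw [mvCoeff_term m k j J K, if_neg]
      omega
    · exact MvPolynomial.coeff_zero _
  · intro h
    exact absurd (mem_range.mpr (by omega)) h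

/-- A binomial coefficient `C(n, r)` with `r ≤ n < p` is nonzero modulo the prime `p`. [folklore] -/
theorem natCast_choose_ne_zero {p : ℕ} [Fact p.Prime] {n r : ℕ} (hrn : r ≤ n) (hnp : n < p) :
    (n.choose r : ZMod p) ≠ 0 := by
  have hp : p.Prime := Fact.out
  rw [Ne, ZMod.natCast_eq_zero_iff]
  intro hdvd
  have h1 : p ∣ n.factorial := by
    rw [← Nat.choose_mul_factorial_mul_factorial hrn, mul_assoc]
    exact dvd_mul_of_dvd_left hdvd _
  exact absurd ((Nat.Prime.dvd_factorial hp).mp h1) (not_le.mpr hnp)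

/-- **The Hasse polynomial is nonzero modulo `p ≥ 5`**: the coefficient of `x^{p-1}` in
`(x³ + A₄x + A₆)^{(p-1)/2} ∈ 𝔽_p[A₄, A₆][x]` is a nonzero polynomial — it contains the monomial
`C(m, m/2) A₄^{m/2}` (`m = (p-1)/2` even) resp. `m·C(m-1, (m+1)/2) A₄^{(m-3)/2} A₆` (`m` odd), whose
coefficient is prime to `p` as `m < p`. (For `p = 3` the coefficient is `0`.) [folklore] -/
theorem coeff_cube_add_pow_ne_zero (p : ℕ) [Fact p.Prime] (hp5 : 5 ≤ p) :
    (((X ^ 3 + C (MvPolynomial.X (0 : Fin 2)) * X + C (MvPolynomial.X (1 : Fin 2))) ^ ((p - 1) / 2)).coeff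
        (2 * ((p - 1) / 2)) : MvPolynomial (Fin 2) (ZMod p)) ≠ 0 := by
  have hp : p.Prime := Fact.out
  set m := (p - 1) / 2 with hm
  have hm2 : 2 ≤ m := by omega
  have hmp : m < p := by omega
  intro h0
  obtain ⟨n, hn | hn⟩ := Nat.even_or_odd' m
  · -- `m = 2n`: the monomial `A₄ⁿ` (`J = n`, `K = 0`)
    have h := mvCoeff_coeff_cube_add_pow (T := ZMod p) (m := m) (J := n) (K := 0) (by omega)
    rw [h0, MvPolynomial.coeff_zero, Nat.sub_zero, Nat.choose_self, Nat.cast_one, one_mul] at h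
    exact natCast_choose_ne_zero (Nat.sub_le m n) hmp h.symm
  · -- `m = 2n + 1 ≥ 3`: the monomial `A₄^{n-1} A₆` (`J = n - 1`, `K = 1`)
    have hn1 : 1 ≤ n := by omega
    have h := mvCoeff_coeff_cube_add_pow (T := ZMod p) (m := m) (J := n - 1) (K := 1) (by omega)
    rw [h0, MvPolynomial.coeff_zero] at h
    have h1 : (m.choose (m - 1) : ZMod p) ≠ 0 := natCast_choose_ne_zero (Nat.sub_le m 1) hmp
    have h2 : ((m - 1).choose (m - 1 - (n - 1)) : ZMod p) ≠ 0 :=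
      natCast_choose_ne_zero (Nat.sub_le _ _) (by omega)
    exact mul_ne_zero h1 h2 h.symm


end HasseComputation

/-! ## The universal coefficient ring `ℤ[A₄, A₆]`, the Hasse polynomial, and `R_H` -/

section CoeffRing

/-- **`R = ℤ[A₄, A₆]`**, the coefficient ring of the universal short Weierstrass curve
(Blakestad–Grant take `ℤ[1/6][A₄,A₆]`; `6` becomes a unit after `p`-adic completion for `p ≥ 5`).
[Blakestad–Grant 2023, §2.1] [cite: BlakestadGrant2023, §2.1] -/
abbrev coeffRing : Type := MvPolynomial (Fin 2) ℤ

/-- The universal coefficient `A₄`. [cite: BlakestadGrant2023, §2.1] -/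
def A₄ : coeffRing := MvPolynomial.X 0

/-- The universal coefficient `A₆`. [cite: BlakestadGrant2023, §2.1] -/
def A₆ : coeffRing := MvPolynomial.X 1

/-- **The universal short Weierstrass curve `y² = x³ + A₄x + A₆` over `ℤ[A₄, A₆]`.**
[cite: BlakestadGrant2023, §2.1] -/
def curve : WeierstrassCurve coeffRing := ⟨0, 0, 0, A₄, A₆⟩

/-- **The Hasse polynomial `H = H_p(A₄, A₆) ∈ ℤ[A₄, A₆]`**: the tree's `hasseCoeff` of the
universal curve, i.e. the coefficient of `x^{p-1}` in `(4x³ + 4A₄x + 4A₆)^{(p-1)/2}`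
(`= 4^{(p-1)/2}·` Blakestad–Grant's `H`, the coefficient of `x^{p-1}` in
`(x³ + A₄x + A₆)^{(p-1)/2}`; the power of `4` is a unit for odd `p`).
[Blakestad–Grant 2023, §2.1 ("`H` … the coefficient of `x^{p-1}` in `(x³ + A₄x + A₆)^{(p-1)/2}`")]
[cite: BlakestadGrant2023, §2.1] -/
def hasse (p : ℕ) : coeffRing := curve.hasseCoeff p

/-- The universal curve specialises to `y² = x³ + a₄x + a₆` under `A₄ ↦ a₄, A₆ ↦ a₆`. [folklore] -/
theorem curve_map_eval₂Hom {A : Type*} [CommRing A] (a₄ a₆ : A) :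
    curve.map (MvPolynomial.eval₂Hom (Int.castRingHom A) ![a₄, a₆]) = ⟨0, 0, 0, a₄, a₆⟩ := by
  simp [curve, A₄, A₆, WeierstrassCurve.map]

/-- The universal curve under a ring map `φ`: `y² = x³ + φ(A₄)x + φ(A₆)`. [folklore] -/
theorem curve_map {A : Type*} [CommRing A] (φ : coeffRing →+* A) :
    curve.map φ = ⟨0, 0, 0, φ A₄, φ A₆⟩ := by
  simp [curve, WeierstrassCurve.map]

/-- `H_p` specialises to the Hasse coefficient of `y² = x³ + a₄x + a₆`. [folklore] -/
theorem eval₂Hom_hasse {A : Type*} [CommRing A] (a₄ a₆ : A) (p : ℕ) :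
    MvPolynomial.eval₂Hom (Int.castRingHom A) ![a₄, a₆] (hasse p) =
      (⟨0, 0, 0, a₄, a₆⟩ : WeierstrassCurve A).hasseCoeff p := by
  rw [hasse, ← WeierstrassCurve.map_hasseCoeff, curve_map_eval₂Hom]

/-- `φ(H_p)` is the Hasse coefficient of the specialised curve. [folklore] -/
theorem map_hasse {A : Type*} [CommRing A] (φ : coeffRing →+* A) (p : ℕ) :
    φ (hasse p) = (⟨0, 0, 0, φ A₄, φ A₆⟩ : WeierstrassCurve A).hasseCoeff p := by
  rw [hasse, ← WeierstrassCurve.map_hasseCoeff, curve_map]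

/-- **The Hasse coefficient of a short curve**: `hasseCoeff (y² = x³ + ax + b) p =
4^{(p-1)/2} · [x^{p-1}] (x³ + ax + b)^{(p-1)/2}`. [folklore] -/
theorem hasseCoeff_short {T : Type*} [CommRing T] (a b : T) (p : ℕ) :
    (⟨0, 0, 0, a, b⟩ : WeierstrassCurve T).hasseCoeff p =
      4 ^ ((p - 1) / 2) * ((X ^ 3 + C a * X + C b) ^ ((p - 1) / 2)).coeff (p - 1) := by
  have h : (⟨0, 0, 0, a, b⟩ : WeierstrassCurve T).twoTorsionPolynomial.toPoly =
      C 4 * (X ^ 3 + C a * X + C b) := by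
    simp only [WeierstrassCurve.twoTorsionPolynomial, WeierstrassCurve.b₂, WeierstrassCurve.b₄,
      WeierstrassCurve.b₆, Cubic.toPoly, map_mul, map_add, map_pow, map_zero, map_ofNat]
    ring
  rw [WeierstrassCurve.hasseCoeff, h, mul_pow, ← map_pow, coeff_C_mul]

/-- **`H_p ≢ 0 (mod p)` for `p ≥ 5`**: the image of the Hasse polynomial in `𝔽_p[A₄, A₆]` is
nonzero (`coeff_cube_add_pow_ne_zero`; for `p = 3` it vanishes). [folklore] -/
theorem hasse_map_ne_zero (p : ℕ) [Fact p.Prime] (hp5 : 5 ≤ p) :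
    MvPolynomial.map (Int.castRingHom (ZMod p)) (hasse p) ≠ 0 := by
  have hp : p.Prime := Fact.out
  have hA₄ : MvPolynomial.map (Int.castRingHom (ZMod p)) A₄ = MvPolynomial.X (0 : Fin 2) :=
    MvPolynomial.map_X _ _
  have hA₆ : MvPolynomial.map (Int.castRingHom (ZMod p)) A₆ = MvPolynomial.X (1 : Fin 2) :=
    MvPolynomial.map_X _ _
  rw [map_hasse, hA₄, hA₆, hasseCoeff_short]
  set m := (p - 1) / 2 with hm
  have h2 : p - 1 = 2 * m := by
    obtain ⟨k, hk⟩ := hp.eq_two_or_odd'.resolve_left (by omega)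
    omega
  rw [h2]
  refine mul_ne_zero (pow_ne_zero _ ?_) (coeff_cube_add_pow_ne_zero p hp5)
  have h4 : ((4 : ℕ) : ZMod p) ≠ 0 := by
    rw [Ne, ZMod.natCast_eq_zero_iff]
    intro h
    have := Nat.le_of_dvd (by norm_num) h
    omega
  rw [← map_ofNat MvPolynomial.C 4, Ne, MvPolynomial.C_eq_zero]
  exact_mod_cast h4

/-- **`H_p ≠ 0` in `ℤ[A₄, A₆]`** for `p ≥ 5`. [folklore] -/
theorem hasse_ne_zero (p : ℕ) [Fact p.Prime] (hp5 : 5 ≤ p) : hasse p ≠ 0 := fun h =>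
  hasse_map_ne_zero p hp5 (by rw [h, map_zero])

/-- The kernel of reduction `ℤ[A₄,A₆] → 𝔽_p[A₄,A₆]` is `(p)`. [folklore] -/
theorem ker_map_castRingHom (p : ℕ) :
    RingHom.ker (MvPolynomial.map (σ := Fin 2) (Int.castRingHom (ZMod p))) =
      Ideal.span {(p : coeffRing)} := by
  rw [MvPolynomial.ker_map, ZMod.ker_intCastRingHom, Ideal.map_span, Set.image_singleton,
    map_natCast]

/-- **`(p)` is a prime ideal of `ℤ[A₄, A₆]`** (`ℤ[A₄,A₆]/(p) = 𝔽_p[A₄,A₆]` is a domain).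
[folklore] -/
theorem span_natCast_isPrime (p : ℕ) [Fact p.Prime] : (Ideal.span {(p : coeffRing)}).IsPrime := by
  rw [← ker_map_castRingHom]
  exact RingHom.ker_isPrime _

/-- `H_p ∉ (p)` for `p ≥ 5`. [folklore] -/
theorem hasse_not_mem_span (p : ℕ) [Fact p.Prime] (hp5 : 5 ≤ p) :
    hasse p ∉ Ideal.span {(p : coeffRing)} := by
  rw [← ker_map_castRingHom, RingHom.mem_ker]
  exact hasse_map_ne_zero p hp5

/-- The powers of `H_p` avoid `(p)`. [folklore] -/
theorem disjoint_powers_hasse_span (p : ℕ) [Fact p.Prime] (hp5 : 5 ≤ p) :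
    Disjoint (Submonoid.powers (hasse p) : Set coeffRing) ↑(Ideal.span {(p : coeffRing)}) := by
  rw [Set.disjoint_left]
  rintro x ⟨k, rfl⟩ hx
  exact hasse_not_mem_span p hp5 ((span_natCast_isPrime p).mem_of_pow_mem k hx)

/-- `p ≠ 0` in `ℤ[A₄, A₆]`. [folklore] -/
theorem natCast_ne_zero {p : ℕ} (hp : p ≠ 0) : (p : coeffRing) ≠ 0 := by
  rw [← map_natCast (MvPolynomial.C : ℤ →+* coeffRing), Ne, MvPolynomial.C_eq_zero, Nat.cast_eq_zero]
  exact hp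

end CoeffRing

/-! ## The localisation `R_H = ℤ[A₄, A₆][1/H_p]` -/

section Localized

/-- **`R_H = ℤ[A₄,A₆][1/H_p]`**. [Blakestad–Grant 2023, §2.1 (`R_H`)] [cite: BlakestadGrant2023, §2.1] -/
abbrev localizedRing (p : ℕ) : Type := Localization.Away (hasse p)

variable (p : ℕ) [Fact p.Prime]

/-- `R_H` is a domain (`p ≥ 5`). [folklore] -/
theorem isDomain_localizedRing (hp5 : 5 ≤ p) : IsDomain (localizedRing p) :=
  IsLocalization.isDomain_localization
    (powers_le_nonZeroDivisors_of_noZeroDivisors (hasse_ne_zero p hp5))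

/-- `ℤ[A₄,A₆] → R_H` is injective (`p ≥ 5`). [folklore] -/
theorem algebraMap_localizedRing_injective (hp5 : 5 ≤ p) :
    Function.Injective (algebraMap coeffRing (localizedRing p)) :=
  IsLocalization.injective (localizedRing p)
    (powers_le_nonZeroDivisors_of_noZeroDivisors (hasse_ne_zero p hp5))

/-- **`(p)` is a prime ideal of `R_H`** (`p ≥ 5`): `R_H/(p) = 𝔽_p[A₄,A₆][1/H̄]` with `H̄ ≠ 0`.
[folklore] -/
theorem span_natCast_isPrime_localizedRing (hp5 : 5 ≤ p) :
    (Ideal.span {(p : localizedRing p)}).IsPrime := by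
  have h := IsLocalization.isPrime_of_isPrime_disjoint (Submonoid.powers (hasse p))
    (localizedRing p) (Ideal.span {(p : coeffRing)}) (span_natCast_isPrime p)
    (disjoint_powers_hasse_span p hp5)
  rwa [Ideal.map_span, Set.image_singleton, map_natCast] at h

/-- `R_H` has no `p`-torsion (`p ≥ 5`). [folklore] -/
theorem eq_zero_of_natCast_mul_eq_zero (hp5 : 5 ≤ p) (x : localizedRing p) (hx : (p : localizedRing p) * x = 0) :
    x = 0 := by
  haveI := isDomain_localizedRing p hp5
  have hp0 : (p : localizedRing p) ≠ 0 := by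
    rw [← map_natCast (algebraMap coeffRing (localizedRing p)), Ne,
      ← (algebraMap coeffRing (localizedRing p)).map_zero,
      (algebraMap_localizedRing_injective p hp5).eq_iff]
    exact natCast_ne_zero (Fact.out : p.Prime).ne_zero
  exact (mul_eq_zero.mp hx).resolve_left hp0

end Localized

/-- `H_p` is a unit of `R_H`. [folklore] -/
theorem isUnit_algebraMap_hasse (p : ℕ) : IsUnit (algebraMap coeffRing (localizedRing p) (hasse p)) :=
  IsLocalization.Away.algebraMap_isUnit (hasse p)

/-! ## The `p`-adic completion `R̂` and the universal ordinary curve -/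

section Complete

/-- **`R̂`, the `p`-adic completion of `R_H = ℤ[A₄, A₆][1/H_p]`** (Mathlib's `AdicCompletion` at
the ideal `(p)`): the base ring of Blakestad–Grant's universal ordinary Weierstrass curve; it is
`p`-adically complete, an integral domain without additive torsion in which `H_p` and every
integer prime to `p` (in particular `6`, for `p ≥ 5`) are units.
[Blakestad–Grant 2023, §2.1 ("let `R̂` denote the `p`-adic completion of `R_H`")]
[cite: BlakestadGrant2023, §2.1] -/
abbrev completeRing (p : ℕ) : Type :=
  AdicCompletion (Ideal.span {(p : localizedRing p)}) (localizedRing p)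

variable (p : ℕ)

/-- **`R̂` is `p`-adically complete** (instance, in the shape
`IsAdicComplete (Ideal.span {(p : R̂)}) R̂` used by the tree's `p`-adic files). [folklore] -/
instance isAdicComplete_completeRing :
    IsAdicComplete (Ideal.span {(p : completeRing p)}) (completeRing p) :=
  isAdicComplete_span_natCast (localizedRing p) p

/-- `ℤ[A₄,A₆] → R̂` factors through `R_H`. [folklore] -/
theorem algebraMap_coeffRing_apply (q : coeffRing) :
    algebraMap coeffRing (completeRing p) q =
      algebraMap (localizedRing p) (completeRing p) (algebraMap coeffRing (localizedRing p) q) := by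
  rw [AdicCompletion.algebraMap_apply, AdicCompletion.algebraMap_apply, Algebra.algebraMap_self,
    RingHom.id_apply]

/-- The universal coefficient `A₄ ∈ R̂`. [cite: BlakestadGrant2023, §2.1] -/
def univA₄ : completeRing p := algebraMap coeffRing (completeRing p) A₄

/-- The universal coefficient `A₆ ∈ R̂`. [cite: BlakestadGrant2023, §2.1] -/
def univA₆ : completeRing p := algebraMap coeffRing (completeRing p) A₆

/-- **The universal ordinary curve `𝓔/R̂ : y² = x³ + A₄x + A₆`.** [Blakestad–Grant 2023, §2.1
("the pair `(ℰ, ω)` defined over `R̂` is the universal … ordinary … curve")]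
[cite: BlakestadGrant2023, §2.1] -/
def universalCurve : WeierstrassCurve (completeRing p) := ⟨0, 0, 0, univA₄ p, univA₆ p⟩

/-- `𝓔` is the base change of the universal curve over `ℤ[A₄,A₆]`. [folklore] -/
theorem curve_map_algebraMap : curve.map (algebraMap coeffRing (completeRing p)) = universalCurve p :=
  curve_map _

/-- `𝓔` has `a₁ = a₃ = 0`. [folklore] -/
instance isCharNeTwoNF_universalCurve : (universalCurve p).IsCharNeTwoNF := ⟨rfl, rfl⟩

/-- `𝓔` is in short Weierstrass form. [folklore] -/
instance isShortNF_universalCurve : (universalCurve p).IsShortNF := ⟨rfl, rfl, rfl⟩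

/-- **`H_p` is a unit of `R̂`.** [Blakestad–Grant 2023, §2.1 (`R_H`: "`H` … invertible in `R̂`")]
[cite: BlakestadGrant2023, §2.1] -/
theorem isUnit_algebraMap_hasse_completeRing :
    IsUnit (algebraMap coeffRing (completeRing p) (hasse p)) := by
  rw [algebraMap_coeffRing_apply]
  exact (isUnit_algebraMap_hasse p).map _

/-- The Hasse coefficient of `𝓔` is (the image of) `H_p`. [folklore] -/
theorem hasseCoeff_universalCurve :
    (universalCurve p).hasseCoeff p = algebraMap coeffRing (completeRing p) (hasse p) := by
  rw [← curve_map_algebraMap, WeierstrassCurve.map_hasseCoeff]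
  rfl

/-- **The Hasse coefficient of the universal ordinary curve is a unit.** [cite: BlakestadGrant2023, §2.1] -/
theorem isUnit_hasseCoeff_universalCurve : IsUnit ((universalCurve p).hasseCoeff p) := by
  rw [hasseCoeff_universalCurve]
  exact isUnit_algebraMap_hasse_completeRing p

variable [Fact p.Prime]

/-- `(p) ⊂ R̂` is prime (`p ≥ 5`). [folklore] -/
theorem span_natCast_isPrime_completeRing (hp5 : 5 ≤ p) :
    (Ideal.span {(p : completeRing p)}).IsPrime := by
  haveI := span_natCast_isPrime_localizedRing p hp5
  have h := span_algebraMap_isPrime (p : localizedRing p)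
  rwa [algebraMap_natCast] at h

/-- **`R̂` is an integral domain** (`p ≥ 5`). [Blakestad–Grant 2023, §2.2 ("Let `K` be the
fraction field of `R̂`")] [cite: BlakestadGrant2023, §2.2] -/
theorem isDomain_completeRing (hp5 : 5 ≤ p) : IsDomain (completeRing p) :=
  haveI := span_natCast_isPrime_localizedRing p hp5
  isDomain_natCast (localizedRing p) p (eq_zero_of_natCast_mul_eq_zero p hp5)

/-- `p` is not a unit of `R̂` (`p ≥ 5`). [folklore] -/
theorem natCast_mem_nonunits (hp5 : 5 ≤ p) : (p : completeRing p) ∈ nonunits (completeRing p) :=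
  fun hu => (span_natCast_isPrime_completeRing p hp5).ne_top
    (Ideal.eq_top_of_isUnit_mem _ (Ideal.mem_span_singleton_self _) hu)

/-- `R̂/(p)` has characteristic `p` (`p ≥ 5`). [folklore] -/
theorem charP_quotient (hp5 : 5 ≤ p) :
    CharP (completeRing p ⧸ Ideal.span {(p : completeRing p)}) p :=
  CharP.quotient (completeRing p) p (natCast_mem_nonunits p hp5)

/-- `pᵏ x = 0 ↔ x = 0` in `R̂` (`p ≥ 5`). [folklore] -/
theorem natCast_pow_mul_eq_zero_iff_completeRing (hp5 : 5 ≤ p) (k : ℕ) (x : completeRing p) :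
    (p : completeRing p) ^ k * x = 0 ↔ x = 0 :=
  natCast_pow_mul_eq_zero_iff (localizedRing p) p (eq_zero_of_natCast_mul_eq_zero p hp5) k x

/-- **`R̂` has no additive torsion** (`p ≥ 5`): an integer `n = pᵏm ≠ 0`, `p ∤ m`, acts
injectively since `m` is a unit of the `p`-adically complete ring `R̂` and `R_H` has no
`p`-torsion. (The hypothesis `[IsAddTorsionFree R]` of the tree's `p`-adic zeta/sigma files.)
[folklore] -/
theorem isAddTorsionFree_completeRing (hp5 : 5 ≤ p) : IsAddTorsionFree (completeRing p) := by
  have hp : p.Prime := Fact.out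
  refine ⟨fun n hn a b hab => ?_⟩
  have h0 : (n : completeRing p) * (a - b) = 0 := by
    have hab' : n • a = n • b := hab
    rw [mul_sub, ← nsmul_eq_mul, ← nsmul_eq_mul, hab', sub_self]
  obtain ⟨k, m, hm, rfl⟩ := Nat.exists_eq_pow_mul_and_not_dvd hn p hp.one_lt.ne'
  have hmu : IsUnit (m : completeRing p) :=
    isUnit_natCast_of_coprime ((Nat.Prime.coprime_iff_not_dvd hp).mpr hm).symm
  rw [Nat.cast_mul, Nat.cast_pow, mul_assoc, natCast_pow_mul_eq_zero_iff_completeRing p hp5,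
    hmu.mul_right_eq_zero, sub_eq_zero] at h0
  exact h0

/-- **The Hasse coefficient `w_{p-1}` of `ω_𝓔 = Σ wₙ zⁿ dz` is a unit of `R̂`** (`p ≥ 5`):
modulo `p` it is the Hasse invariant `H_p` (the tree's `coeff_formalInvDiff_prime_sub_one`,
Blakestad–Grant's "`H₁ = w_{p-1} ≡ H`"), and units lift from `R̂/(p)`. This is the ordinarity
hypothesis of the tree's `p`-adic Weierstrass zeta function (`PadicWeierstrassZetaProofs`).
[Blakestad–Grant 2023, Prop. 3(b) and Remark] [cite: BlakestadGrant2023, Prop. 3] -/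
theorem isUnit_coeff_formalInvDiff_universalCurve (hp5 : 5 ≤ p) :
    IsUnit (PowerSeries.coeff (p - 1) (universalCurve p).formalInvDiff) := by
  have hp : p.Prime := Fact.out
  obtain ⟨m, hpm⟩ : ∃ m, p = 2 * m + 1 := hp.eq_two_or_odd'.resolve_left (by omega)
  haveI := charP_quotient p hp5
  set π := Ideal.Quotient.mk (Ideal.span {(p : completeRing p)}) with hπ
  refine isUnit_of_isUnit_mk (Ideal.span {(p : completeRing p)}) ?_
  rw [← hπ, ← PowerSeries.coeff_map, WeierstrassCurve.map_formalInvDiff,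
    WeierstrassCurve.coeff_formalInvDiff_prime_sub_one _ p hpm, WeierstrassCurve.map_hasseCoeff]
  exact (isUnit_hasseCoeff_universalCurve p).map _

/-- All the Hasse coefficients `w_{pⁿ⁺¹-1}` of `ω_𝓔` are units of `R̂` (`p ≥ 5`; the tree's
`isUnit_coeff_formalInvDiff_prime_pow_sub_one`, Blakestad–Grant Prop. 3(b)).
[cite: BlakestadGrant2023, Prop. 3] -/
theorem isUnit_coeff_formalInvDiff_universalCurve_pow (hp5 : 5 ≤ p) (n : ℕ) :
    IsUnit (PowerSeries.coeff (p ^ (n + 1) - 1) (universalCurve p).formalInvDiff) :=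
  (universalCurve p).isUnit_coeff_formalInvDiff_prime_pow_sub_one p (by omega)
    (isUnit_coeff_formalInvDiff_universalCurve p hp5) n

end Complete

/-! ## Specialisation (Blakestad–Grant, Thm. 15) -/

section Specialize

variable (p : ℕ) {A : Type*} [CommRing A]

/-- The specialisation `R_H → A`, `A₄ ↦ a₄`, `A₆ ↦ a₆`, for a curve `y² = x³ + a₄x + a₆` over
`A` whose Hasse coefficient is a unit. [cite: BlakestadGrant2023, Thm. 15] -/
def specializeAway (a₄ a₆ : A) (h : IsUnit ((⟨0, 0, 0, a₄, a₆⟩ : WeierstrassCurve A).hasseCoeff p)) :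
    localizedRing p →+* A :=
  IsLocalization.Away.lift (hasse p) (g := MvPolynomial.eval₂Hom (Int.castRingHom A) ![a₄, a₆])
    (by rwa [eval₂Hom_hasse])

/-- `specializeAway` on `ℤ[A₄,A₆]` is evaluation at `(a₄, a₆)`. [folklore] -/
theorem specializeAway_algebraMap (a₄ a₆ : A)
    (h : IsUnit ((⟨0, 0, 0, a₄, a₆⟩ : WeierstrassCurve A).hasseCoeff p)) (q : coeffRing) :
    specializeAway p a₄ a₆ h (algebraMap coeffRing (localizedRing p) q) =
      MvPolynomial.eval₂Hom (Int.castRingHom A) ![a₄, a₆] q :=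
  IsLocalization.Away.lift_eq (hasse p) _ q

variable [IsAdicComplete (Ideal.span {(p : A)}) A]

/-- **The specialisation `ρ : R̂ → A`** at an ordinary short Weierstrass curve
`y² = x³ + a₄x + a₆` over a `p`-adically complete ring `A` (unit Hasse coefficient):
`A₄ ↦ a₄`, `A₆ ↦ a₆`, extended to `R_H` because `ρ(H)` is a unit and to `R̂` by completeness.
[Blakestad–Grant 2023, Thm. 15 ("`ρ` extends to a map on `R_H`, and then to a map on `R̂` since
`A` is `p`-complete")] [cite: BlakestadGrant2023, Thm. 15] -/
def specialize (a₄ a₆ : A) (h : IsUnit ((⟨0, 0, 0, a₄, a₆⟩ : WeierstrassCurve A).hasseCoeff p)) :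
    completeRing p →+* A :=
  liftNatCast (localizedRing p) p (specializeAway p a₄ a₆ h)

variable (a₄ a₆ : A) (h : IsUnit ((⟨0, 0, 0, a₄, a₆⟩ : WeierstrassCurve A).hasseCoeff p))

/-- `ρ` on `ℤ[A₄,A₆]` is evaluation at `(a₄, a₆)`. [folklore] -/
theorem specialize_algebraMap (q : coeffRing) :
    specialize p a₄ a₆ h (algebraMap coeffRing (completeRing p) q) =
      MvPolynomial.eval₂Hom (Int.castRingHom A) ![a₄, a₆] q := by
  rw [algebraMap_coeffRing_apply, specialize, liftNatCast_algebraMap, specializeAway_algebraMap]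

/-- `ρ(A₄) = a₄`. [cite: BlakestadGrant2023, Thm. 15] -/
theorem specialize_univA₄ : specialize p a₄ a₆ h (univA₄ p) = a₄ := by
  rw [univA₄, specialize_algebraMap, A₄, MvPolynomial.coe_eval₂Hom, MvPolynomial.eval₂_X]
  rfl

/-- `ρ(A₆) = a₆`. [cite: BlakestadGrant2023, Thm. 15] -/
theorem specialize_univA₆ : specialize p a₄ a₆ h (univA₆ p) = a₆ := by
  rw [univA₆, specialize_algebraMap, A₆, MvPolynomial.coe_eval₂Hom, MvPolynomial.eval₂_X]
  rfl

/-- **`ρ_* 𝓔 = (y² = x³ + a₄x + a₆)`**: the universal curve specialises to the given one.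
[cite: BlakestadGrant2023, Thm. 15] -/
theorem universalCurve_map_specialize :
    (universalCurve p).map (specialize p a₄ a₆ h) = ⟨0, 0, 0, a₄, a₆⟩ := by
  simp only [universalCurve, WeierstrassCurve.map, map_zero, specialize_univA₄, specialize_univA₆]

/-- `ρ(H_p)` is the Hasse coefficient of the given curve. [folklore] -/
theorem specialize_hasse :
    specialize p a₄ a₆ h (algebraMap coeffRing (completeRing p) (hasse p)) =
      (⟨0, 0, 0, a₄, a₆⟩ : WeierstrassCurve A).hasseCoeff p := by
  rw [specialize_algebraMap, eval₂Hom_hasse]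

end Specialize

/-- **Ring maps out of `R̂` into a `p`-adically separated ring are determined by the images of
`A₄` and `A₆`** (so `specialize` and `frobeniusLift` below are the unique such maps).
[folklore] -/
theorem ringHom_ext (p : ℕ) {B : Type*} [CommRing B] [IsHausdorff (Ideal.span {(p : B)}) B]
    {ψ ψ' : completeRing p →+* B} (h₄ : ψ (univA₄ p) = ψ' (univA₄ p))
    (h₆ : ψ (univA₆ p) = ψ' (univA₆ p)) : ψ = ψ' := by
  refine ringHom_ext_natCast (R := localizedRing p) p fun r => ?_
  suffices hcomp : ψ.comp (algebraMap (localizedRing p) (completeRing p)) =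
      ψ'.comp (algebraMap (localizedRing p) (completeRing p)) from RingHom.congr_fun hcomp r
  refine IsLocalization.ringHom_ext (Submonoid.powers (hasse p)) ?_
  refine MvPolynomial.ringHom_ext (fun n => by simp only [eq_intCast, map_intCast]) fun i => ?_
  simp only [RingHom.comp_apply, ← algebraMap_coeffRing_apply]
  fin_cases i
  · exact h₄
  · exact h₆

/-! ## Frobenius lifts (Blakestad–Grant, Def. 8) -/

section Frobenius

variable (p : ℕ) [Fact p.Prime]

/-- **Frobenius congruences on `ℤ[A₄, A₆]`**: if `I ∋ p` and `b₄ ≡ φ(A₄)ᵖ`, `b₆ ≡ φ(A₆)ᵖ (mod I)`,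
then evaluation at `(b₄, b₆)` is congruent to `φ(·)ᵖ` modulo `I` on all of `ℤ[A₄,A₆]`
(integers satisfy `r ≡ rᵖ`, and `(u + v)ᵖ ≡ uᵖ + vᵖ (mod p)`). [folklore] -/
theorem eval₂Hom_sub_pow_mem {B : Type*} [CommRing B] (φ : coeffRing →+* B) (b₄ b₆ : B)
    (I : Ideal B) (hpI : (p : B) ∈ I) (h₄ : b₄ - φ A₄ ^ p ∈ I) (h₆ : b₆ - φ A₆ ^ p ∈ I)
    (q : coeffRing) : MvPolynomial.eval₂Hom (Int.castRingHom B) ![b₄, b₆] q - φ q ^ p ∈ I := by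
  have hp : p.Prime := Fact.out
  induction q using MvPolynomial.induction_on with
  | C r =>
    rw [MvPolynomial.coe_eval₂Hom, MvPolynomial.eval₂_C, eq_intCast, eq_intCast, map_intCast]
    have hdvd : (p : ℤ) ∣ r - r ^ p := by
      rw [← ZMod.intCast_zmod_eq_zero_iff_dvd, Int.cast_sub, Int.cast_pow, ZMod.pow_card, sub_self]
    obtain ⟨c, hc⟩ := hdvd
    have e : ((r : B) - (r : B) ^ p) = (p : B) * (c : B) := by exact_mod_cast congrArg (Int.cast (R := B)) hc
    rw [e]
    exact I.mul_mem_right _ hpI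
  | add q₁ q₂ ih₁ ih₂ =>
    obtain ⟨c, hc⟩ := exists_add_pow_prime_eq hp (φ q₁) (φ q₂)
    have e : MvPolynomial.eval₂Hom (Int.castRingHom B) ![b₄, b₆] (q₁ + q₂) - φ (q₁ + q₂) ^ p =
        (MvPolynomial.eval₂Hom (Int.castRingHom B) ![b₄, b₆] q₁ - φ q₁ ^ p) +
        (MvPolynomial.eval₂Hom (Int.castRingHom B) ![b₄, b₆] q₂ - φ q₂ ^ p) -
        (p : B) * φ q₁ * φ q₂ * c := by
      rw [map_add, map_add, hc]; ring
    rw [e]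
    exact sub_mem (add_mem ih₁ ih₂) (I.mul_mem_right _ (I.mul_mem_right _ (I.mul_mem_right _ hpI)))
  | mul_X q i ih =>
    have e : MvPolynomial.eval₂Hom (Int.castRingHom B) ![b₄, b₆] (q * MvPolynomial.X i) -
        φ (q * MvPolynomial.X i) ^ p =
        (MvPolynomial.eval₂Hom (Int.castRingHom B) ![b₄, b₆] q - φ q ^ p) * ![b₄, b₆] i +
          φ q ^ p * (![b₄, b₆] i - φ (MvPolynomial.X i) ^ p) := by
      rw [map_mul, map_mul, MvPolynomial.coe_eval₂Hom, MvPolynomial.eval₂_X, mul_pow]; ring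
    rw [e]
    refine add_mem (I.mul_mem_right _ ih) (I.mul_mem_left _ ?_)
    fin_cases i
    · exact h₄
    · exact h₆

variable (A'₄ A'₆ : completeRing p)
  (h₄ : A'₄ - univA₄ p ^ p ∈ Ideal.span {(p : completeRing p)})
  (h₆ : A'₆ - univA₆ p ^ p ∈ Ideal.span {(p : completeRing p)})

/-- The evaluation `ℤ[A₄,A₆] → R̂`, `Aᵢ ↦ A'ᵢ`. [cite: BlakestadGrant2023, Def. 8] -/
def frobeniusPoly : coeffRing →+* completeRing p :=
  MvPolynomial.eval₂Hom (Int.castRingHom (completeRing p)) ![A'₄, A'₆]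

include h₄ h₆ in
/-- `Aᵢ ↦ A'ᵢ` is congruent to Frobenius on `ℤ[A₄,A₆]`. [cite: BlakestadGrant2023, Def. 8] -/
theorem frobeniusPoly_sub_pow_mem (q : coeffRing) :
    frobeniusPoly p A'₄ A'₆ q - algebraMap coeffRing (completeRing p) q ^ p ∈
      Ideal.span {(p : completeRing p)} :=
  eval₂Hom_sub_pow_mem p (algebraMap coeffRing (completeRing p)) A'₄ A'₆ _
    (Ideal.mem_span_singleton_self _) h₄ h₆ q

include h₄ h₆ in
/-- **`H(A'₄, A'₆) ≡ H^p (mod p)` is a unit of `R̂`.** [Blakestad–Grant 2023, Def. 8 ("`α(H)` is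
`H^p` mod `p`, so is invertible in `R̂`")] [cite: BlakestadGrant2023, Def. 8] -/
theorem isUnit_frobeniusPoly_hasse : IsUnit (frobeniusPoly p A'₄ A'₆ (hasse p)) := by
  refine isUnit_of_isUnit_mk (Ideal.span {(p : completeRing p)}) ?_
  rw [Ideal.Quotient.eq.mpr (frobeniusPoly_sub_pow_mem p A'₄ A'₆ h₄ h₆ (hasse p))]
  exact ((isUnit_algebraMap_hasse_completeRing p).pow p).map _

/-- The extension of `Aᵢ ↦ A'ᵢ` to `R_H`. [cite: BlakestadGrant2023, Def. 8] -/
def frobeniusAway : localizedRing p →+* completeRing p :=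
  IsLocalization.Away.lift (hasse p) (isUnit_frobeniusPoly_hasse p A'₄ A'₆ h₄ h₆)

/-- `frobeniusAway` on `ℤ[A₄,A₆]`. [folklore] -/
theorem frobeniusAway_algebraMap (q : coeffRing) :
    frobeniusAway p A'₄ A'₆ h₄ h₆ (algebraMap coeffRing (localizedRing p) q) =
      frobeniusPoly p A'₄ A'₆ q :=
  IsLocalization.Away.lift_eq (hasse p) _ q

/-- `frobeniusAway` is congruent to Frobenius on `R_H`: for `z = q/s`, `s ∈ H^ℕ`,
`α(z)·α(s) = α(q) ≡ qᵖ = zᵖsᵖ ≡ zᵖ α(s)` with `α(s)` a unit. [folklore] -/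
theorem frobeniusAway_sub_pow_mem (z : localizedRing p) :
    frobeniusAway p A'₄ A'₆ h₄ h₆ z - algebraMap (localizedRing p) (completeRing p) z ^ p ∈
      Ideal.span {(p : completeRing p)} := by
  set I := Ideal.span {(p : completeRing p)} with hI
  set f := frobeniusAway p A'₄ A'₆ h₄ h₆ with hf
  set u := algebraMap (localizedRing p) (completeRing p) with hu
  obtain ⟨⟨q, s⟩, hqs⟩ := IsLocalization.surj (Submonoid.powers (hasse p)) z
  simp only at hqs
  -- `z * s = q` in `R_H`
  have hsu : IsUnit (algebraMap coeffRing (localizedRing p) (s : coeffRing)) :=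
    IsLocalization.map_units (localizedRing p) s
  have hunit : IsUnit (f (algebraMap coeffRing (localizedRing p) s)) := hsu.map f
  have hc : f (algebraMap coeffRing (localizedRing p) q) -
      u (algebraMap coeffRing (localizedRing p) q) ^ p ∈ I := by
    rw [hf, frobeniusAway_algebraMap, hu, ← algebraMap_coeffRing_apply]
    exact frobeniusPoly_sub_pow_mem p A'₄ A'₆ h₄ h₆ q
  have hs : f (algebraMap coeffRing (localizedRing p) s) -
      u (algebraMap coeffRing (localizedRing p) s) ^ p ∈ I := by
    rw [hf, frobeniusAway_algebraMap, hu, ← algebraMap_coeffRing_apply]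
    exact frobeniusPoly_sub_pow_mem p A'₄ A'₆ h₄ h₆ s
  have e : (f z - u z ^ p) * f (algebraMap coeffRing (localizedRing p) s) =
      (f (algebraMap coeffRing (localizedRing p) q) - u (algebraMap coeffRing (localizedRing p) q) ^ p) +
        u z ^ p * (u (algebraMap coeffRing (localizedRing p) s) ^ p -
          f (algebraMap coeffRing (localizedRing p) s)) := by
    have h1 : f z * f (algebraMap coeffRing (localizedRing p) s) =
        f (algebraMap coeffRing (localizedRing p) q) := by rw [← map_mul, hqs]
    have h2 : u z ^ p * u (algebraMap coeffRing (localizedRing p) s) ^ p =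
        u (algebraMap coeffRing (localizedRing p) q) ^ p := by rw [← mul_pow, ← map_mul, hqs]
    rw [sub_mul, h1, ← h2]; ring
  rw [← Ideal.mul_unit_mem_iff_mem I hunit, e]
  exact add_mem hc (I.mul_mem_left _ (by rw [← neg_sub]; exact I.neg_mem hs))

/-- **The Frobenius lift `α : R̂ → R̂` with `α(A₄) = A'₄`, `α(A₆) = A'₆`** attached to elements
`A'ᵢ ≡ Aᵢᵖ (mod p)` of `R̂` (in Blakestad–Grant: `A'ᵢ = A'_{i,p/H}`, the coefficients of the
quotient of `𝓔` by its canonical subgroup, Prop. 7(b)); `α` extends to `R_H` since `α(H)` is a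
unit and to `R̂` by completeness. [Blakestad–Grant 2023, Def. 8] [cite: BlakestadGrant2023, Def. 8] -/
def frobeniusLift : completeRing p →+* completeRing p :=
  liftNatCast (localizedRing p) p (frobeniusAway p A'₄ A'₆ h₄ h₆)

/-- `α` on `ℤ[A₄,A₆]` is `Aᵢ ↦ A'ᵢ`. [folklore] -/
theorem frobeniusLift_algebraMap (q : coeffRing) :
    frobeniusLift p A'₄ A'₆ h₄ h₆ (algebraMap coeffRing (completeRing p) q) =
      frobeniusPoly p A'₄ A'₆ q := by
  rw [algebraMap_coeffRing_apply, frobeniusLift, liftNatCast_algebraMap, frobeniusAway_algebraMap]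

/-- `α(A₄) = A'₄`. [cite: BlakestadGrant2023, Def. 8] -/
theorem frobeniusLift_univA₄ : frobeniusLift p A'₄ A'₆ h₄ h₆ (univA₄ p) = A'₄ := by
  rw [univA₄, frobeniusLift_algebraMap, frobeniusPoly, A₄, MvPolynomial.coe_eval₂Hom,
    MvPolynomial.eval₂_X]
  rfl

/-- `α(A₆) = A'₆`. [cite: BlakestadGrant2023, Def. 8] -/
theorem frobeniusLift_univA₆ : frobeniusLift p A'₄ A'₆ h₄ h₆ (univA₆ p) = A'₆ := by
  rw [univA₆, frobeniusLift_algebraMap, frobeniusPoly, A₆, MvPolynomial.coe_eval₂Hom,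
    MvPolynomial.eval₂_X]
  rfl

/-- **`α` reduces to the Frobenius modulo `p`: `α(x) ≡ xᵖ (mod p)` for all `x ∈ R̂`.**
[Blakestad–Grant 2023, Def. 8 ("`α` extends uniquely to `R_H` and thence to `R̂`, where it still
reduces to the Frobenius mod `p`")] [cite: BlakestadGrant2023, Def. 8] -/
theorem frobeniusLift_sub_pow_mem (x : completeRing p) :
    frobeniusLift p A'₄ A'₆ h₄ h₆ x - x ^ p ∈ Ideal.span {(p : completeRing p)} := by
  have h := sub_pow_mem_span_of_forall_algebraMap (p : localizedRing p) p
    (frobeniusLift p A'₄ A'₆ h₄ h₆) ?_ ?_ x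
  · rwa [algebraMap_natCast] at h
  · rw [algebraMap_natCast, map_natCast]
    exact Ideal.mem_span_singleton_self _
  · intro z
    rw [algebraMap_natCast, frobeniusLift, liftNatCast_algebraMap]
    exact frobeniusAway_sub_pow_mem p A'₄ A'₆ h₄ h₆ z

/-- `α` is the unique ring endomorphism of `R̂` with `α(A₄) = A'₄`, `α(A₆) = A'₆`.
[cite: BlakestadGrant2023, Def. 8] -/
theorem eq_frobeniusLift {α : completeRing p →+* completeRing p} (hα₄ : α (univA₄ p) = A'₄)
    (hα₆ : α (univA₆ p) = A'₆) : α = frobeniusLift p A'₄ A'₆ h₄ h₆ :=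
  ringHom_ext p (by rw [hα₄, frobeniusLift_univA₄]) (by rw [hα₆, frobeniusLift_univA₆])

/-- `α(H_p) ≡ H_pᵖ` is a unit, so **`α(𝓔)` is again a curve of the universal ordinary family
over `R̂`** with unit Hasse coefficient `H(A'₄, A'₆)`. [Blakestad–Grant 2023, Def. 8 ("`H' = H(A'₄,
A'₆) ≡ Hᵖ mod p`, so `H'` is invertible in `R̂`")] [cite: BlakestadGrant2023, Def. 8] -/
theorem isUnit_hasseCoeff_map_frobeniusLift :
    IsUnit (((universalCurve p).map (frobeniusLift p A'₄ A'₆ h₄ h₆)).hasseCoeff p) := by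
  rw [← curve_map_algebraMap, WeierstrassCurve.map_map, WeierstrassCurve.map_hasseCoeff,
    RingHom.comp_apply, ← hasse, frobeniusLift_algebraMap]
  exact isUnit_frobeniusPoly_hasse p A'₄ A'₆ h₄ h₆

end Frobenius

/-! ## Ordinarity: `H` unit `↔` `w_{p-1}` unit, over any `p`-adically complete ring -/

/-- **Over a `p`-adically complete ring (`p` an odd prime) the Hasse coefficient of a Weierstrass
equation is a unit iff the coefficient `w_{p-1}` of its invariant differential is** — both agree
modulo `p` (the tree's `coeff_formalInvDiff_prime_sub_one`, Blakestad–Grant's `H₁ = w_{p-1} ≡ H`)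
and units lift from `A/(p)`. This converts the tree's ordinarity hypothesis `‖c_{p-1}‖ = 1`
(`mazur_tate_sigma_existsUnique_of_exists_shortModel`) into the hypothesis of `specialize`.
[Blakestad–Grant 2023, Remark after Prop. 3; Thm. 15 ("Since `E` is ordinary, `ρ(H)` is a unit")]
[cite: BlakestadGrant2023, Thm. 15] -/
theorem isUnit_hasseCoeff_iff_isUnit_coeff_formalInvDiff {A : Type*} [CommRing A] (p : ℕ)
    [Fact p.Prime] [IsAdicComplete (Ideal.span {(p : A)}) A] (hp2 : p ≠ 2) (V : WeierstrassCurve A) :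
    IsUnit (V.hasseCoeff p) ↔ IsUnit (PowerSeries.coeff (p - 1) V.formalInvDiff) := by
  have hp : p.Prime := Fact.out
  obtain ⟨m, hpm⟩ : ∃ m, p = 2 * m + 1 := hp.eq_two_or_odd'.resolve_left hp2
  by_cases hu : IsUnit (p : A)
  · -- `p ∈ Aˣ` and `A` `p`-adically separated force `A = 0`
    haveI : Subsingleton A := subsingleton_of_forall_eq 0 fun x =>
      IsHausdorff.haus' (I := Ideal.span {(p : A)}) x fun n => by
        rw [SModEq.zero, smul_eq_mul, Ideal.mul_top, Ideal.span_singleton_pow,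
          Ideal.span_singleton_eq_top.mpr (hu.pow n)]
        exact Submodule.mem_top
    exact ⟨fun _ => isUnit_of_subsingleton _, fun _ => isUnit_of_subsingleton _⟩
  · haveI := CharP.quotient A p hu
    rw [isUnit_iff_isUnit_mk (Ideal.span {(p : A)}) (V.hasseCoeff p),
      isUnit_iff_isUnit_mk (Ideal.span {(p : A)}) (PowerSeries.coeff (p - 1) V.formalInvDiff),
      ← WeierstrassCurve.map_hasseCoeff, ← WeierstrassCurve.coeff_formalInvDiff_prime_sub_one _ p hpm,
      ← WeierstrassCurve.map_formalInvDiff, PowerSeries.coeff_map]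

end Literature.NumberTheory.EllipticCurves.UniversalOrdinary
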